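import Literature.Computability.Cryptography.PolyTimeComputableRealsSqrt
import Mathlib.Analysis.InnerProductSpace.GramSchmidtOrtho
import Mathlib.Analysis.InnerProductSpace.PiL2
import HarnessLib

/-!
# Gram–Schmidt inside the polynomial-time computable numbers: adapted orthonormal bases with `C̃` entries

Toolkit for Bernstein–Vazirani's change-of-basis constructions (SIAM J. Comput. 26 (1997),
§5.1 Lemma 5.1 "a set of vectors `B` from `C̃^Q` which forms an orthonormal basis", §5.3
Lemma 5.5 (unidirection: "choose orthonormal bases `B_L` and `B_R` for the spaces `C_L` and
`C_R`") and Lemma 5.7 (completion)): the bases have to consist of vectors with POLYNOMIAL-TIME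
COMPUTABLE coordinates (`IsPolyTimeComputableComplex`, BV Def. 3.2, the class `C̃`), so that the
new transition amplitudes `∑ ⟨v|p⟩⟨q|v'⟩ δ(p,σ,τ,q,d)` are again in `C̃`. Since `P_ℝ` is a field
closed under square roots (Ko 1991, §2; `PolyTimeComputableRealsSqrt.lean`), the Gram–Schmidt
process stays inside `C̃`:

* `IsPolyTimeComputableComplex.finset_sum`, `.inv_ofReal`, `.inner`, `.norm` — sums, inner
  products and norms of vectors with `C̃` coordinates;
* `gramSchmidt_polyTime`, `gramSchmidtNormed_polyTime` — Mathlib's `gramSchmidt` /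
  `gramSchmidtNormed` of a family with `C̃` coordinates has `C̃` coordinates;
* **`exists_orthonormal_adapted_polyTime`** — for a finite family `g` of vectors of `ℂ^Λ` with
  `C̃` coordinates there is an orthonormal basis `b : Λ → ℂ^Λ` with `C̃` coordinates every vector
  of which lies in `span g` or in `(span g)ᗮ` (Gram–Schmidt on `g` followed by the standard
  basis).

No named facts.

## References

* E. Bernstein, U. Vazirani, *Quantum complexity theory*, SIAM J. Comput. 26 (1997) 1411–1473
  [BernsteinVaziraniSICOMP1997]: Def. 3.2, Lemma 5.1, Lemma 5.5 (proof), Lemma 5.7.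
* K.-I. Ko, *Complexity Theory of Real Functions*, Birkhäuser 1991, §2.1–2.2 [Ko1991].
-/

noncomputable section

namespace Literature.Computability.Cryptography

open InnerProductSpace
open scoped BigOperators ComplexConjugate InnerProductSpace

/-! ### Sums, inner products, norms -/

/-- Finite sums of polynomial-time computable complex numbers. [cite: Ko1991, §2.1] -/
theorem IsPolyTimeComputableComplex.finset_sum {ι : Type*} (s : Finset ι) (f : ι → ℂ)
    (h : ∀ i ∈ s, IsPolyTimeComputableComplex (f i)) : IsPolyTimeComputableComplex (∑ i ∈ s, f i) := by
  classical
  induction s using Finset.induction_on with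
  | empty =>
    simp only [Finset.sum_empty]
    exact ⟨by simpa using isPolyTimeComputableReal_zero, by simpa using isPolyTimeComputableReal_zero⟩
  | insert a s ha ih =>
    rw [Finset.sum_insert ha]
    exact (h a (by simp)).add (ih fun i hi => h i (by simp [hi]))

/-- Finite sums of polynomial-time computable reals. [cite: Ko1991, §2.1] -/
theorem IsPolyTimeComputableReal.finset_sum {ι : Type*} (s : Finset ι) (f : ι → ℝ)
    (h : ∀ i ∈ s, IsPolyTimeComputableReal (f i)) : IsPolyTimeComputableReal (∑ i ∈ s, f i) := by
  classical
  induction s using Finset.induction_on with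
  | empty => simpa using isPolyTimeComputableReal_zero
  | insert a s ha ih =>
    rw [Finset.sum_insert ha]
    exact (h a (by simp)).add (ih fun i hi => h i (by simp [hi]))

/-- The real and imaginary parts of a `C̃` number are in `P_ℝ`. [cite: BernsteinVaziraniSICOMP1997, Def. 3.2] -/
theorem IsPolyTimeComputableComplex.re {z : ℂ} (h : IsPolyTimeComputableComplex z) : IsPolyTimeComputableReal z.re := h.1

/-- The squared modulus of a `C̃` number is in `P_ℝ`. [cite: Ko1991, §2.1] -/
theorem IsPolyTimeComputableComplex.normSq {z : ℂ} (h : IsPolyTimeComputableComplex z) :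
    IsPolyTimeComputableReal (Complex.normSq z) := by
  rw [Complex.normSq_apply]
  exact (h.1.mul h.1).add (h.2.mul h.2)

/-- `‖z‖²` of a `C̃` number is in `P_ℝ`. [cite: Ko1991, §2.1] -/
theorem IsPolyTimeComputableComplex.norm_sq {z : ℂ} (h : IsPolyTimeComputableComplex z) :
    IsPolyTimeComputableReal (‖z‖ ^ 2) := by
  rw [← Complex.normSq_eq_norm_sq]
  exact h.normSq

/-- The inverse of a real `C̃` number, as a complex number. [cite: Ko1991, §2.2] -/
theorem IsPolyTimeComputableComplex.inv_ofReal {r : ℝ} (h : IsPolyTimeComputableReal r) :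
    IsPolyTimeComputableComplex ((r : ℂ)⁻¹) := by
  rw [← Complex.ofReal_inv]
  exact IsPolyTimeComputableComplex.ofReal h.inv

variable {Λ : Type*}

/-- A vector of `ℂ^Λ` has polynomial-time computable coordinates. [cite: BernsteinVaziraniSICOMP1997, Def. 3.2] -/
def PolyTimeVec (v : EuclideanSpace ℂ Λ) : Prop := ∀ q, IsPolyTimeComputableComplex (v q)

section Basic

/-- Inner products of `C̃` vectors are in `C̃`. [cite: Ko1991, §2.1] -/
theorem PolyTimeVec.inner [Fintype Λ] {u v : EuclideanSpace ℂ Λ} (hu : PolyTimeVec u) (hv : PolyTimeVec v) :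
    IsPolyTimeComputableComplex ⟪u, v⟫_ℂ := by
  rw [PiLp.inner_apply]
  exact IsPolyTimeComputableComplex.finset_sum _ _ fun q _ => by
    simpa [RCLike.inner_apply] using (hv q).mul (hu q).conj

/-- Norms of `C̃` vectors are in `P_ℝ` (a square root of a sum of squares). [cite: Ko1991, §2.2] -/
theorem PolyTimeVec.norm [Fintype Λ] {u : EuclideanSpace ℂ Λ} (hu : PolyTimeVec u) : IsPolyTimeComputableReal ‖u‖ := by
  rw [EuclideanSpace.norm_eq]
  exact (IsPolyTimeComputableReal.finset_sum _ _ fun q _ => (hu q).norm_sq).sqrt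

/-- `C̃` vectors form a `ℂ̃`-submodule: zero. [folklore] -/
theorem PolyTimeVec.zero : PolyTimeVec (0 : EuclideanSpace ℂ Λ) := fun _ =>
  ⟨by simpa using isPolyTimeComputableReal_zero, by simpa using isPolyTimeComputableReal_zero⟩

/-- Sums of `C̃` vectors. [folklore] -/
theorem PolyTimeVec.add {u v : EuclideanSpace ℂ Λ} (hu : PolyTimeVec u) (hv : PolyTimeVec v) : PolyTimeVec (u + v) :=
  fun q => by simpa using (hu q).add (hv q)

/-- Differences of `C̃` vectors. [folklore] -/
theorem PolyTimeVec.sub {u v : EuclideanSpace ℂ Λ} (hu : PolyTimeVec u) (hv : PolyTimeVec v) : PolyTimeVec (u - v) :=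
  fun q => by simpa using (hu q).sub (hv q)

/-- Scalar multiples of `C̃` vectors by `C̃` scalars. [folklore] -/
theorem PolyTimeVec.smul {c : ℂ} {u : EuclideanSpace ℂ Λ} (hc : IsPolyTimeComputableComplex c) (hu : PolyTimeVec u) :
    PolyTimeVec (c • u) :=
  fun q => by simpa using hc.mul (hu q)

/-- Finite sums of `C̃` vectors. [folklore] -/
theorem PolyTimeVec.finset_sum {ι : Type*} (s : Finset ι) {f : ι → EuclideanSpace ℂ Λ}
    (h : ∀ i ∈ s, PolyTimeVec (f i)) : PolyTimeVec (∑ i ∈ s, f i) := by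
  classical
  induction s using Finset.induction_on with
  | empty => simpa using PolyTimeVec.zero
  | insert a s ha ih =>
    rw [Finset.sum_insert ha]
    exact (h a (by simp)).add (ih fun i hi => h i (by simp [hi]))

/-- The standard basis vectors have `C̃` coordinates. [folklore] -/
theorem polyTimeVec_single [DecidableEq Λ] (q : Λ) : PolyTimeVec (EuclideanSpace.single q (1 : ℂ)) := fun q' => by
  rw [EuclideanSpace.single, PiLp.single_apply]
  split_ifs
  · exact ⟨by simpa using isPolyTimeComputableReal_one, by simpa using isPolyTimeComputableReal_zero⟩
  · exact ⟨by simpa using isPolyTimeComputableReal_zero, by simpa using isPolyTimeComputableReal_zero⟩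

end Basic

/-! ### Gram–Schmidt -/

section GS

variable [Fintype Λ]

/-- **Gram–Schmidt stays inside `C̃`**: if every `f i` has `C̃` coordinates, so does every
`gramSchmidt ℂ f n` (by strong induction on `n`, from
`gramSchmidt f n = f n - ∑_{i<n} (⟪g_i, f n⟫ / ‖g_i‖²) g_i`). [cite: BernsteinVaziraniSICOMP1997, Lemma 5.5 (proof)] -/
theorem gramSchmidt_polyTime {m : ℕ} {f : Fin m → EuclideanSpace ℂ Λ} (hf : ∀ i, PolyTimeVec (f i)) :
    ∀ n, PolyTimeVec (gramSchmidt ℂ f n) := by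
  intro n
  induction n using WellFoundedLT.induction with
  | ind n ih =>
    have h := gramSchmidt_def'' ℂ f n
    have hsum : PolyTimeVec (∑ i ∈ Finset.Iio n,
        (⟪gramSchmidt ℂ f i, f n⟫_ℂ / (‖gramSchmidt ℂ f i‖ : ℂ) ^ 2) • gramSchmidt ℂ f i) := by
      refine PolyTimeVec.finset_sum _ fun i hi => ?_
      rw [Finset.mem_Iio] at hi
      refine PolyTimeVec.smul ?_ (ih i hi)
      rw [div_eq_mul_inv, ← Complex.ofReal_pow]
      exact ((ih i hi).inner (hf n)).mul (IsPolyTimeComputableComplex.inv_ofReal ((ih i hi).norm.pow 2))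
    have : gramSchmidt ℂ f n = f n - ∑ i ∈ Finset.Iio n,
        (⟪gramSchmidt ℂ f i, f n⟫_ℂ / (‖gramSchmidt ℂ f i‖ : ℂ) ^ 2) • gramSchmidt ℂ f i :=
      eq_sub_of_add_eq h.symm
    rw [this]
    exact (hf n).sub hsum

/-- The normalised Gram–Schmidt vectors have `C̃` coordinates (division by a norm in `P_ℝ`). [cite: BernsteinVaziraniSICOMP1997, Lemma 5.5 (proof)] -/
theorem gramSchmidtNormed_polyTime {m : ℕ} {f : Fin m → EuclideanSpace ℂ Λ} (hf : ∀ i, PolyTimeVec (f i)) (n : Fin m) :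
    PolyTimeVec (gramSchmidtNormed ℂ f n) := by
  unfold gramSchmidtNormed
  exact PolyTimeVec.smul (IsPolyTimeComputableComplex.inv_ofReal (gramSchmidt_polyTime hf n).norm)
    (gramSchmidt_polyTime hf n)

/-- Orthogonality to a spanning set gives membership in the orthogonal complement of the span. [folklore] -/
theorem mem_orthogonal_span_of_forall {E : Type*} [NormedAddCommGroup E] [InnerProductSpace ℂ E] {S : Set E} {v : E}
    (h : ∀ u ∈ S, ⟪u, v⟫_ℂ = 0) : v ∈ (Submodule.span ℂ S)ᗮ := by
  rw [Submodule.mem_orthogonal]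
  intro u hu
  induction hu using Submodule.span_induction with
  | mem u hu => exact h u hu
  | zero => exact inner_zero_left _
  | add u w _ _ hu hw => rw [inner_add_left, hu, hw, add_zero]
  | smul c u _ hu => rw [inner_smul_left, hu, mul_zero]

/-- **An orthonormal basis of `ℂ^Λ` with `C̃` coordinates adapted to the span of a `C̃` family**
(Bernstein–Vazirani 1997, proof of Lemma 5.5: "choose orthonormal bases `B_L` and `B_R` for the
spaces `C_L` and `C_R`", the vectors being taken from `C̃^Q` as in Lemma 5.1): for a finite family
`g` of vectors with polynomial-time computable coordinates there is an orthonormal family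
`b : Λ → ℂ^Λ` (hence a basis) with polynomial-time computable coordinates, every vector of which
lies in `span g` or in `(span g)ᗮ`. Construction: Gram–Schmidt on `g` followed by the standard
basis, discarding the zero vectors. [cite: BernsteinVaziraniSICOMP1997, Lemma 5.5 (proof)] -/
theorem exists_orthonormal_adapted_polyTime [DecidableEq Λ] {κ : Type*} [Fintype κ]
    (g : κ → EuclideanSpace ℂ Λ) (hg : ∀ k, PolyTimeVec (g k)) :
    ∃ b : Λ → EuclideanSpace ℂ Λ, Orthonormal ℂ b ∧ (∀ i, PolyTimeVec (b i)) ∧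
      ∀ i, b i ∈ Submodule.span ℂ (Set.range g) ∨ b i ∈ (Submodule.span ℂ (Set.range g))ᗮ := by
  classical
  set m := Fintype.card κ with hm
  set N := Fintype.card Λ with hN
  let eκ : κ ≃ Fin m := Fintype.equivFin κ
  let eΛ : Λ ≃ Fin N := Fintype.equivFin Λ
  set f : Fin (m + N) → EuclideanSpace ℂ Λ :=
    Fin.append (fun i => g (eκ.symm i)) (fun j => EuclideanSpace.single (eΛ.symm j) (1 : ℂ)) with hfdef
  have hf : ∀ i, PolyTimeVec (f i) := fun i => by
    induction i using Fin.addCases with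
    | left i => simp only [f, Fin.append_left]; exact hg _
    | right j => simp only [f, Fin.append_right]; exact polyTimeVec_single _
  set G : Fin (m + N) → EuclideanSpace ℂ Λ := gramSchmidtNormed ℂ f with hG
  -- the non-zero normalised Gram–Schmidt vectors: orthonormal and spanning
  let T : Set (Fin (m + N)) := {i | G i ≠ 0}
  have hON : Orthonormal ℂ (fun i : T => G i) := gramSchmidtNormed_orthonormal' f
  have hspan_f : Submodule.span ℂ (Set.range f) = ⊤ := by
    refine eq_top_iff.2 ?_
    have hb := (EuclideanSpace.basisFun Λ ℂ).toBasis.span_eq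
    rw [OrthonormalBasis.coe_toBasis] at hb
    rw [← hb]
    refine Submodule.span_mono ?_
    rintro _ ⟨q, rfl⟩
    refine ⟨Fin.natAdd m (eΛ q), ?_⟩
    simp [f, Fin.append_right]
  have hspan_T : Submodule.span ℂ (Set.range fun i : T => G i) = ⊤ := by
    have h1 : Submodule.span ℂ (Set.range G) = ⊤ := by
      rw [hG, span_gramSchmidtNormed_range, span_gramSchmidt, hspan_f]
    apply le_antisymm le_top
    rw [← h1]
    refine Submodule.span_le.2 ?_
    rintro _ ⟨i, rfl⟩
    by_cases hi : G i = 0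
    · rw [hi]; exact zero_mem _
    · exact Submodule.subset_span ⟨⟨i, hi⟩, rfl⟩
  -- hence a basis, of cardinality `|Λ|`
  have hli := hON.linearIndependent
  let B : Module.Basis T ℂ (EuclideanSpace ℂ Λ) := Module.Basis.mk hli (by rw [hspan_T])
  have hcard : Fintype.card T = Fintype.card Λ := by
    have := Module.finrank_eq_card_basis B
    rw [finrank_euclideanSpace] at this
    exact this.symm
  let eT : Λ ≃ T := Fintype.equivOfCardEq hcard.symm
  refine ⟨fun q => G (eT q), hON.comp eT eT.injective, fun q => ?_, fun q => ?_⟩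
  · exact gramSchmidtNormed_polyTime hf _
  · -- adaptedness
    have hrange : Set.range g = f '' Set.Iio (⟨m, by have := Fintype.card_pos_iff.2 ⟨q⟩; omega⟩ : Fin (m + N)) := by
      ext v
      simp only [Set.mem_range, Set.mem_image, Set.mem_Iio]
      constructor
      · rintro ⟨k, rfl⟩
        refine ⟨Fin.castAdd N (eκ k), ?_, ?_⟩
        · show ((Fin.castAdd N (eκ k) : Fin (m + N)) : ℕ) < m
          simp
        · simp [f, Fin.append_left]
      · rintro ⟨i, hi, rfl⟩
        have hi' : (i : ℕ) < m := hi
        refine ⟨eκ.symm ⟨i, hi'⟩, ?_⟩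
        have hcast : Fin.castAdd N ⟨i, hi'⟩ = i := Fin.ext rfl
        calc g (eκ.symm ⟨i, hi'⟩) = f (Fin.castAdd N ⟨i, hi'⟩) := by rw [hfdef, Fin.append_left]
          _ = f i := by rw [hcast]
    set t : Fin (m + N) := ((eT q : T) : Fin (m + N)) with ht
    by_cases htm : (t : ℕ) < m
    · left
      -- `G t ∈ span (f '' Iic t) ⊆ span (range g)`
      have h1 : gramSchmidt ℂ f t ∈ Submodule.span ℂ (f '' Set.Iic t) := gramSchmidt_mem_span ℂ f le_rfl
      have h2 : Submodule.span ℂ (f '' Set.Iic t) ≤ Submodule.span ℂ (Set.range g) := by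
        rw [hrange]
        refine Submodule.span_mono (Set.image_mono fun i hi => ?_)
        simp only [Set.mem_Iic, Set.mem_Iio] at hi ⊢
        exact lt_of_le_of_lt (show (i : ℕ) ≤ t from hi) htm
      show G t ∈ _
      rw [hG, gramSchmidtNormed]
      exact Submodule.smul_mem _ _ (h2 h1)
    · right
      have hspan_g : Submodule.span ℂ (Set.range g) =
          Submodule.span ℂ (gramSchmidt ℂ f '' Set.Iio ⟨m, by have := Fintype.card_pos_iff.2 ⟨q⟩; omega⟩) := by
        rw [hrange, span_gramSchmidt_Iio]
      show G t ∈ _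
      rw [hspan_g]
      refine mem_orthogonal_span_of_forall fun u hu => ?_
      obtain ⟨i, hi, rfl⟩ := hu
      have hit : i ≠ t := by
        intro h
        rw [← h] at htm
        exact htm hi
      rw [hG, gramSchmidtNormed, inner_smul_right, gramSchmidt_orthogonal ℂ f hit, mul_zero]

end GS

end Literature.Computability.Cryptography

end
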